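import Literature.AlgebraicGeometry.Motives.UniversalHypersurfaceRegularLocusTopology
import Literature.AlgebraicGeometry.Motives.UniversalHypersurfaceRegularLocusEquation
import HarnessLib

/-!
# Coordinates on the whole universal hypersurface `𝒴(ℂ)`, and the regular locus in coordinates

Family `hodge`, layer `Literature/AlgebraicGeometry/Motives`; sequel of `UniversalHypersurfaceRegularLocusCoordinates` / `…Equation` /
`…Topology`. Those files coordinatise the REGULAR locus `𝒴°(ℂ)`; the compactness arguments of the degeneration programme
(`HodgeTheory/CyclicCoverNodalMeridianLocalMonodromyBound`: the fibre-singular points over a small ball of forms stay near the node) need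
the same coordinates on ALL of `𝒴(ℂ) = (totalSpaceOver k n d)(ℂ)`, singular points included, and the description of `𝒴° ⊆ 𝒴` in them:

* §1 `totalOverι`, `totalOverToProjectiveSpace`, `tPointHom`, `tCoeff`, `tForm` — as in the regular-locus file, for `𝒴`; compatible with
  `regularToTotalSpaceOver : 𝒴° ↪ 𝒴` (`tPointHom_map_regularToTotalSpaceOver`, `hypersurfacePoint_map_regularToTotalSpaceOver`);
* §2 `eq_of_hypersurfacePoint_eq_of_tCoeff_eq` — a complex point of `𝒴` is determined by `(b, [z])`;
* §3 `tFiberLift` and **the equation** `hypersurfacePoint_mem_projZeroLocus_tForm`: `Σ_m b_m(P) z^m = 0` for every `P ∈ 𝒴(ℂ)`;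
* §4 **the regular locus in coordinates** (`mem_range_map_regularToTotalSpaceOver_iff`): `P ∈ 𝒴(ℂ)` comes from `𝒴°(ℂ)` iff some partial
  `∂_j F_{b(P)}` does not vanish at `[z](P)` (`mem_regularLocus_iff` read through the fibre lift).

Everything is proved; the definitions are the concrete ones listed; no named facts.

## References

* [VoisinHodgeII2003] C. Voisin, Hodge Theory and Complex Algebraic Geometry II (2003), §6.2.1, §2.3.1.
* [Hartshorne1977] R. Hartshorne, Algebraic Geometry (1977), I Ex. 5.8 (Jacobian criterion), II.3, II Ex. 2.7.
* [SerreGAGA1956] J.-P. Serre, Géométrie algébrique et géométrie analytique, Ann. Inst. Fourier 6 (1956), §2 n°5.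
-/

noncomputable section

open CategoryTheory CategoryTheory.Limits AlgebraicGeometry MvPolynomial TopologicalSpace

universe u

namespace Literature.AlgebraicGeometry.Motives.UniversalHypersurface

attribute [local instance] MvPolynomial.gradedAlgebra ProjBaseChange.algebraBase
  ProjBaseChange.isScalarTower_localization

/-! ### §1 Coordinates on `𝒴` -/

section Scheme

variable (k : Type u) [Field k] (n d : ℕ)

/-- `𝒴 ↪ ℙⁿ⁺¹_R`, typed out of `(totalSpaceOver k n d).left`. [cite: VoisinHodgeII2003, §6.2.1] -/
def totalOverι : (totalSpaceOver k n d).left ⟶ projSp n (CoeffRing k n d) := totalι k n d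

/-- `𝒴 → S^d`, typed out of `(totalSpaceOver k n d).left`. [cite: VoisinHodgeII2003, §6.2.1] -/
def totalOverToSpec' : (totalSpaceOver k n d).left ⟶ Spec (.of (CoeffRing k n d)) := totalToSpec k n d

/-- `totalOverToSpec' = totalOverι ≫ (ℙⁿ⁺¹_R → S^d)` (`rfl`). [cite: VoisinHodgeII2003, §6.2.1] -/
theorem totalOverToSpec'_eq : totalOverToSpec' k n d = totalOverι k n d ≫ projSpToSpec n (CoeffRing k n d) := rfl

/-- `(totalSpaceOver k n d).hom = totalOverToSpec' ≫ (S^d → Spec k)` (`rfl`). [cite: VoisinHodgeII2003, §6.2.1] -/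
theorem totalSpaceOver_hom_eq : (totalSpaceOver k n d).hom = totalOverToSpec' k n d ≫ specCoeffToSpec k n d := rfl

/-- `𝒴 ↪ ℙⁿ⁺¹_R` is a monomorphism (closed immersion). [cite: Hartshorne1977, II Ex. 3.11] -/
theorem mono_totalOverι : Mono (totalOverι k n d) :=
  inferInstanceAs (Mono (totalι k n d))

/-- `regularToTotalSpaceOver.left ≫ totalOverι = regularTotalι` (`rfl`). [cite: VoisinHodgeII2003, §6.2.1] -/
theorem regularToTotalSpaceOver_left_comp_totalOverι :
    (regularToTotalSpaceOver k n d).left ≫ totalOverι k n d = regularTotalι k n d := rfl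

/-- **The projection `𝒴 → ℙⁿ⁺¹_k`** as a morphism of `k`-schemes. [cite: VoisinHodgeII2003, §6.2.1] -/
def totalOverToProjectiveSpace : totalSpaceOver k n d ⟶ Motives.projectiveSpace (n + 1) k :=
  Over.homMk (totalOverι k n d ≫ HodgeTheory.UniversalHypersurface.projSpToProjSp k n d) (by
    change (totalOverι k n d ≫ HodgeTheory.UniversalHypersurface.projSpToProjSp k n d) ≫ projSpToSpec n k =
      totalOverToSpec' k n d ≫ specCoeffToSpec k n d
    rw [totalOverToSpec'_eq]
    simp only [Category.assoc, HodgeTheory.UniversalHypersurface.projSpToProjSp_comp_projSpToSpec])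

/-- `regularToTotalSpaceOver ≫ totalOverToProjectiveSpace = regularToProjectiveSpace`. [cite: VoisinHodgeII2003, §6.2.1] -/
theorem regularToTotalSpaceOver_comp_totalOverToProjectiveSpace :
    regularToTotalSpaceOver k n d ≫ totalOverToProjectiveSpace k n d = regularToProjectiveSpace k n d :=
  Over.OverMorphism.ext rfl

variable {K : Type u} [Field K] [Algebra k K]

/-- The **coefficient homomorphism** `R → K` of a `K`-point of `𝒴`. [cite: VoisinHodgeII2003, §6.2.1] -/
def tPointHom (P : AlgPoints (totalSpaceOver k n d) K) : CommRingCat.of (CoeffRing k n d) ⟶ CommRingCat.of K :=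
  Spec.preimage (P.toSpecHom ≫ totalOverToSpec' k n d)

/-- `Spec (tPointHom P) = P ≫ (𝒴 → S^d)`. [cite: VoisinHodgeII2003, §6.2.1] -/
theorem Spec_map_tPointHom (P : AlgPoints (totalSpaceOver k n d) K) :
    Spec.map (tPointHom k n d P) = P.toSpecHom ≫ totalOverToSpec' k n d :=
  Spec.map_preimage _

/-- The coefficient homomorphism restricts to the structure map on `k`. [cite: VoisinHodgeII2003, §6.2.1] -/
theorem tPointHom_comp_algebraMap (P : AlgPoints (totalSpaceOver k n d) K) :
    (tPointHom k n d P).hom.comp (algebraMap k (CoeffRing k n d)) = algebraMap k K := by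
  have hw : Spec.map (tPointHom k n d P) ≫ specCoeffToSpec k n d = Spec.map (CommRingCat.ofHom (algebraMap k K)) := by
    rw [Spec_map_tPointHom, Category.assoc]
    exact Over.w P
  rw [← Spec.map_comp] at hw
  have := congrArg CommRingCat.Hom.hom (Spec.map_injective hw)
  simpa using this

/-- The **coefficient vector** of a `K`-point of `𝒴`. [cite: VoisinHodgeII2003, §6.2.1] -/
def tCoeff (P : AlgPoints (totalSpaceOver k n d) K) : DegIndex n d → K := fun m => (tPointHom k n d P).hom (X m)

/-- The coefficient homomorphism is evaluation at the coefficient vector. [cite: VoisinHodgeII2003, §6.2.1] -/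
theorem tPointHom_hom_eq_aeval (P : AlgPoints (totalSpaceOver k n d) K) :
    (tPointHom k n d P).hom = (MvPolynomial.aeval (tCoeff k n d P)).toRingHom := by
  refine MvPolynomial.ringHom_ext (fun r => ?_) fun m => ?_
  · have hs := congrArg (fun φ : k →+* K => φ r) (tPointHom_comp_algebraMap k n d P)
    simp only [RingHom.comp_apply] at hs
    rw [MvPolynomial.algebraMap_eq] at hs
    rw [hs, AlgHom.toRingHom_eq_coe, RingHom.coe_coe, MvPolynomial.algHom_C]
  · rw [AlgHom.toRingHom_eq_coe, RingHom.coe_coe, MvPolynomial.aeval_X]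
    rfl

/-- The **form** `F_P = Σ_m b_m(P) x^m` of a `K`-point of `𝒴`. [cite: VoisinHodgeII2003, §6.2.1] -/
def tForm (P : AlgPoints (totalSpaceOver k n d) K) : MvPolynomial (Fin (n + 2)) K :=
  MvPolynomial.map (tPointHom k n d P).hom (universalForm k n d)

/-- `F_P` is homogeneous of degree `d`. [cite: VoisinHodgeII2003, §6.2.1] -/
theorem isHomogeneous_tForm (P : AlgPoints (totalSpaceOver k n d) K) : (tForm k n d P).IsHomogeneous d :=
  (isHomogeneous_universalForm k n d).map _

/-- `F_P = formOfCoeffs (tCoeff P)`. [cite: VoisinHodgeII2003, §6.2.1] -/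
theorem tForm_eq_formOfCoeffs (P : AlgPoints (totalSpaceOver k n d) K) : tForm k n d P = formOfCoeffs (tCoeff k n d P) := by
  rw [tForm, formOfCoeffs_def, universalForm]
  simp only [map_sum, map_monomial]
  rfl

/-- **Compatibility with `𝒴° ↪ 𝒴`**: the coefficient homomorphisms agree. [cite: VoisinHodgeII2003, §6.2.1] -/
theorem tPointHom_map_regularToTotalSpaceOver (Q : AlgPoints (regularTotal k n d) K) :
    tPointHom k n d (AlgPoints.map (regularToTotalSpaceOver k n d) Q) = regPointHom k n d Q := by
  apply Spec.map_injective
  rw [Spec_map_tPointHom, Spec_map_regPointHom]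
  rfl

/-- The coefficient vectors agree along `𝒴° ↪ 𝒴`. [cite: VoisinHodgeII2003, §6.2.1] -/
theorem tCoeff_map_regularToTotalSpaceOver (Q : AlgPoints (regularTotal k n d) K) :
    tCoeff k n d (AlgPoints.map (regularToTotalSpaceOver k n d) Q) = regCoeff k n d Q := by
  funext m
  rw [tCoeff, tPointHom_map_regularToTotalSpaceOver]
  rfl

/-! ### §2 A point of `𝒴` is determined by `(b, [z])` -/

/-- **A `K`-point of `𝒴` is determined by its images in `ℙⁿ⁺¹_k` and in `S^d`** (`ℙⁿ⁺¹_R = ℙⁿ⁺¹_k ×_k S^d`, and `𝒴 ↪ ℙⁿ⁺¹_R` is a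
monomorphism). [cite: Hartshorne1977, II.3 and II Ex. 2.7] -/
theorem eq_of_map_eq_of_tCoeff_eq {P P' : AlgPoints (totalSpaceOver k n d) K}
    (h₁ : AlgPoints.map (totalOverToProjectiveSpace k n d) P = AlgPoints.map (totalOverToProjectiveSpace k n d) P')
    (h₂ : tCoeff k n d P = tCoeff k n d P') : P = P' := by
  have hsq := Motives.ProjBaseChangeRing.isPullback_projMap' k (CoeffRing k n d) (n := n + 1)
  have hφ : tPointHom k n d P = tPointHom k n d P' := by
    ext1
    rw [tPointHom_hom_eq_aeval, tPointHom_hom_eq_aeval, h₂]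
  have key : P.toSpecHom ≫ totalOverι k n d = P'.toSpecHom ≫ totalOverι k n d := by
    refine hsq.hom_ext ?_ ?_
    · change (P.toSpecHom ≫ totalOverι k n d) ≫ HodgeTheory.UniversalHypersurface.projSpToProjSp k n d =
        (P'.toSpecHom ≫ totalOverι k n d) ≫ HodgeTheory.UniversalHypersurface.projSpToProjSp k n d
      simp only [Category.assoc]
      exact congrArg CommaMorphism.left h₁
    · change (P.toSpecHom ≫ totalOverι k n d) ≫ projSpToSpec n (CoeffRing k n d) =
        (P'.toSpecHom ≫ totalOverι k n d) ≫ projSpToSpec n (CoeffRing k n d)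
      simp only [Category.assoc]
      change P.toSpecHom ≫ totalOverToSpec' k n d = P'.toSpecHom ≫ totalOverToSpec' k n d
      rw [← Spec_map_tPointHom, ← Spec_map_tPointHom, hφ]
  haveI := mono_totalOverι k n d
  exact Over.OverMorphism.ext ((cancel_mono (totalOverι k n d)).mp key)

/-! ### §3 The fibre lift and the equation -/

/-- The base change `ℙⁿ⁺¹_K → ℙⁿ⁺¹_R` along the coefficient homomorphism of `P`. [cite: Hartshorne1977, II.3 (base change)] -/
def tProjMap (P : AlgPoints (totalSpaceOver k n d) K) : projSp n K ⟶ projSp n (CoeffRing k n d) :=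
  letI : Algebra (CoeffRing k n d) K := (tPointHom k n d P).hom.toAlgebra
  Proj.map (ProjBaseChangeRing.mapGraded (CoeffRing k n d) K (Fin (n + 2)))
    (ProjBaseChangeRing.irrelevant_le_map (CoeffRing k n d) K (Fin (n + 2)))

/-- `ℙⁿ⁺¹_K = ℙⁿ⁺¹_R ×_{S^d} Spec K` over the coefficient homomorphism of `P`. [cite: Hartshorne1977, II.3] -/
theorem isPullback_tProjMap (P : AlgPoints (totalSpaceOver k n d) K) :
    IsPullback (tProjMap k n d P) (projSpToSpec n K) (projSpToSpec n (CoeffRing k n d)) (Spec.map (tPointHom k n d P)) := by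
  letI : Algebra (CoeffRing k n d) K := (tPointHom k n d P).hom.toAlgebra
  have h := ProjBaseChangeRing.isPullback_projMap' (CoeffRing k n d) K (n := n + 1)
  have halg : CommRingCat.ofHom (algebraMap (CoeffRing k n d) K) = tPointHom k n d P := by
    ext1; rfl
  rw [halg] at h
  exact h

/-- On points, `tProjMap P` contracts homogeneous primes along `G ↦ G_P`. [cite: Hartshorne1977, II Ex. 2.14 (b) and II.3] -/
theorem mem_tProjMap_apply_iff (P : AlgPoints (totalSpaceOver k n d) K) (q : projSp n K)
    (G : MvPolynomial (Fin (n + 2)) (CoeffRing k n d)) :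
    G ∈ (tProjMap k n d P q).asHomogeneousIdeal ↔ MvPolynomial.map (tPointHom k n d P).hom G ∈ q.asHomogeneousIdeal :=
  Iff.rfl

/-- **The fibre lift** of a `K`-point of `𝒴`: the `K`-point of `ℙⁿ⁺¹_K` with components `P ≫ (𝒴 ↪ ℙⁿ⁺¹_R)` and `𝟙`.
[cite: Hartshorne1977, II.3] -/
def tFiberLift (P : AlgPoints (totalSpaceOver k n d) K) : Spec (.of K) ⟶ projSp n K :=
  (isPullback_tProjMap k n d P).lift (P.toSpecHom ≫ totalOverι k n d) (𝟙 _) (by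
    rw [Category.id_comp, Spec_map_tPointHom, Category.assoc, totalOverToSpec'_eq])

/-- `tFiberLift P ≫ (ℙⁿ⁺¹_K → ℙⁿ⁺¹_R) = P ≫ (𝒴 ↪ ℙⁿ⁺¹_R)`. [cite: Hartshorne1977, II.3] -/
@[reassoc]
theorem tFiberLift_comp_tProjMap (P : AlgPoints (totalSpaceOver k n d) K) :
    tFiberLift k n d P ≫ tProjMap k n d P = P.toSpecHom ≫ totalOverι k n d :=
  IsPullback.lift_fst _ _ _ _

/-- The point of `ℙⁿ⁺¹_R` under `P` is the image of the fibre lift's point. [cite: Hartshorne1977, II.3] -/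
theorem tProjMap_base_tFiberLift (P : AlgPoints (totalSpaceOver k n d) K) (x : Spec (.of K)) :
    (tProjMap k n d P).base ((tFiberLift k n d P).base x) = (totalOverι k n d).base (P.toSpecHom.base x) := by
  have := congrArg (fun f => f.base x) (tFiberLift_comp_tProjMap k n d P)
  simpa only [Scheme.Hom.comp_apply] using this

/-- For `G ∈ R[x]`: `G` vanishes at the point of `ℙⁿ⁺¹_R` under `P` iff `G_P` vanishes at the fibre lift's point.
[cite: Hartshorne1977, II.3] -/
theorem mem_ideal_totalOverι_iff (P : AlgPoints (totalSpaceOver k n d) K) (x : Spec (.of K))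
    (G : MvPolynomial (Fin (n + 2)) (CoeffRing k n d)) :
    G ∈ ((totalOverι k n d).base (P.toSpecHom.base x)).asHomogeneousIdeal ↔
      MvPolynomial.map (tPointHom k n d P).hom G ∈ ((tFiberLift k n d P).base x).asHomogeneousIdeal := by
  rw [← tProjMap_base_tFiberLift, mem_tProjMap_apply_iff]

/-- **The fibre lift lies on `V₊(F_P)`.** [cite: VoisinHodgeII2003, §6.2.1] -/
theorem tFiberLift_base_mem_zeroLocus (P : AlgPoints (totalSpaceOver k n d) K) (x : Spec (.of K)) :
    (tFiberLift k n d P).base x ∈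
      ProjectiveSpectrum.zeroLocus (MvPolynomial.homogeneousSubmodule (Fin (n + 2)) K) {tForm k n d P} := by
  have hmem : (totalOverι k n d).base (P.toSpecHom.base x) ∈
      ProjectiveSpectrum.zeroLocus (MvPolynomial.homogeneousSubmodule (Fin (n + 2)) (CoeffRing k n d))
        {universalForm k n d} := by
    change (totalι k n d).base (P.toSpecHom.base x) ∈ _
    rw [← range_totalι]
    exact Set.mem_range_self _
  have hsub : ({universalForm k n d} : Set (MvPolynomial (Fin (n + 2)) (CoeffRing k n d))) ⊆
      ((totalOverι k n d).base (P.toSpecHom.base x) : ProjectiveSpectrum _).asHomogeneousIdeal := hmem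
  rw [Set.singleton_subset_iff, SetLike.mem_coe, mem_ideal_totalOverι_iff] at hsub
  change ({tForm k n d P} : Set (MvPolynomial (Fin (n + 2)) K)) ⊆ _
  rw [Set.singleton_subset_iff, SetLike.mem_coe]
  exact hsub

end Scheme

/-! ### §3 (over `ℂ`) and §4: the equation and the regular locus in coordinates -/

section Complex

variable (n d : ℕ)

/-- `Proj` of a graded endomorphism of `R[x₀, …, x_m]` which is pointwise the identity is the identity (Mathlib `Proj.map_id`).
[cite: Hartshorne1977, II Ex. 2.14] -/
private theorem Proj_map_eq_id_of_forall_eq' {R : Type u} [CommRing R] {m : ℕ}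
    (f : MvPolynomial.homogeneousSubmodule (Fin m) R →+*ᵍ MvPolynomial.homogeneousSubmodule (Fin m) R)
    (hf : HomogeneousIdeal.irrelevant (MvPolynomial.homogeneousSubmodule (Fin m) R) ≤
      (HomogeneousIdeal.irrelevant (MvPolynomial.homogeneousSubmodule (Fin m) R)).map f)
    (h : ∀ x, f x = x) : Proj.map f hf = 𝟙 (Proj (MvPolynomial.homogeneousSubmodule (Fin m) R)) := by
  have hid : f = GradedRingHom.id (MvPolynomial.homogeneousSubmodule (Fin m) R) := GradedRingHom.ext h
  subst hid
  exact Proj.map_id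

/-- Over `k = K = ℂ` the fibre lift IS the point `P ≫ (𝒴 → ℙⁿ⁺¹_ℂ)`. [cite: Hartshorne1977, II.3] -/
theorem map_totalOverToProjectiveSpace_left (P : ComplexPoints (totalSpaceOver ℂ n d)) :
    (AlgPoints.map (totalOverToProjectiveSpace ℂ n d) P).left = tFiberLift ℂ n d P := by
  letI : Algebra (CoeffRing ℂ n d) ℂ := (tPointHom ℂ n d P).hom.toAlgebra
  have hcomp : tProjMap ℂ n d P ≫ HodgeTheory.UniversalHypersurface.projSpToProjSp ℂ n d = 𝟙 _ := by
    rw [tProjMap, HodgeTheory.UniversalHypersurface.projSpToProjSp, ← Proj.map_comp]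
    refine Proj_map_eq_id_of_forall_eq' _ _ fun x => ?_
    change MvPolynomial.map (algebraMap (CoeffRing ℂ n d) ℂ) (MvPolynomial.map (algebraMap ℂ (CoeffRing ℂ n d)) x) = x
    rw [MvPolynomial.map_map, RingHom.algebraMap_toAlgebra, tPointHom_comp_algebraMap, Algebra.algebraMap_self,
      MvPolynomial.map_id]
  change P.toSpecHom ≫ totalOverι ℂ n d ≫ HodgeTheory.UniversalHypersurface.projSpToProjSp ℂ n d = _
  rw [← reassoc_of% (tFiberLift_comp_tProjMap ℂ n d P), hcomp, Category.comp_id]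

/-- The point of `ℙⁿ⁺¹_ℂ` under `P` is the fibre lift's point. [cite: Hartshorne1977, II.3] -/
theorem pt_map_totalOverToProjectiveSpace (P : ComplexPoints (totalSpaceOver ℂ n d)) :
    (AlgPoints.map (totalOverToProjectiveSpace ℂ n d) P).pt = (tFiberLift ℂ n d P).base (IsLocalRing.closedPoint ℂ) := by
  have hl : (AlgPoints.map (totalOverToProjectiveSpace ℂ n d) P).toSpecHom = tFiberLift ℂ n d P :=
    map_totalOverToProjectiveSpace_left n d P
  exact congrArg (fun f : Spec (.of ℂ) ⟶ projSp n ℂ => f.base (IsLocalRing.closedPoint ℂ)) hl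

/-- For a homogeneous `G ∈ ℂ[x]`: `[z](P) ∈ V(G) ⊆ ℙ(ℂⁿ⁺²)` iff `G` lies in the homogeneous prime of the point of `ℙⁿ⁺¹_ℂ` under `P`.
[cite: SerreGAGA1956, §2 n°5] -/
theorem hypersurfacePoint_mem_projZeroLocus_iff (P : ComplexPoints (totalSpaceOver ℂ n d)) {G : MvPolynomial (Fin (n + 2)) ℂ}
    {e : ℕ} (hG : G.IsHomogeneous e) :
    HodgeTheory.hypersurfacePoint (totalOverToProjectiveSpace ℂ n d) P ∈ Projectivization.projZeroLocus {G} ↔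
      G ∈ ((tFiberLift ℂ n d P).base (IsLocalRing.closedPoint ℂ)).asHomogeneousIdeal := by
  rw [← pt_map_totalOverToProjectiveSpace]
  have key := Set.ext_iff.mp (Literature.NumberTheory.Transcendental.preimage_projPoint_setOf_pt_mem_basicOpen (n + 1) G e hG)
    (HodgeTheory.hypersurfacePoint (totalOverToProjectiveSpace ℂ n d) P)
  rw [Set.mem_preimage, Set.mem_setOf_eq, HodgeTheory.projPoint_hypersurfacePoint, Set.mem_compl_iff] at key
  constructor
  · intro h
    by_contra hG'
    exact (key.mp ((Proj.mem_basicOpen _ _ _).mpr hG')) h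
  · intro h
    by_contra h'
    exact ((Proj.mem_basicOpen _ _ _).mp (key.mpr h')) h

/-- **A complex point of `𝒴` lies on the hypersurface of its own form**: `Σ_m b_m(P) z^m = 0`. [cite: VoisinHodgeII2003, §6.2.1] -/
theorem hypersurfacePoint_mem_projZeroLocus_tForm (P : ComplexPoints (totalSpaceOver ℂ n d)) :
    HodgeTheory.hypersurfacePoint (totalOverToProjectiveSpace ℂ n d) P ∈ Projectivization.projZeroLocus {tForm ℂ n d P} := by
  rw [hypersurfacePoint_mem_projZeroLocus_iff n d P (isHomogeneous_tForm ℂ n d P)]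
  have h := tFiberLift_base_mem_zeroLocus ℂ n d P (IsLocalRing.closedPoint ℂ)
  have hsub : ({tForm ℂ n d P} : Set (MvPolynomial (Fin (n + 2)) ℂ)) ⊆ _ := h
  exact Set.singleton_subset_iff.mp hsub

/-- **A complex point of `𝒴` is determined by `([z], b)`.** [cite: SerreGAGA1956, §2 n°5] [cite: Hartshorne1977, II.3] -/
theorem eq_of_hypersurfacePoint_eq_of_tCoeff_eq {P P' : ComplexPoints (totalSpaceOver ℂ n d)}
    (h₁ : HodgeTheory.hypersurfacePoint (totalOverToProjectiveSpace ℂ n d) P =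
      HodgeTheory.hypersurfacePoint (totalOverToProjectiveSpace ℂ n d) P')
    (h₂ : tCoeff ℂ n d P = tCoeff ℂ n d P') : P = P' := by
  refine eq_of_map_eq_of_tCoeff_eq ℂ n d ?_ h₂
  rw [← HodgeTheory.projPoint_hypersurfacePoint, ← HodgeTheory.projPoint_hypersurfacePoint, h₁]

/-- Homogeneous coordinates are compatible with `𝒴° ↪ 𝒴`. [cite: SerreGAGA1956, §2 n°5] -/
theorem hypersurfacePoint_map_regularToTotalSpaceOver (Q : ComplexPoints (regularTotal ℂ n d)) :
    HodgeTheory.hypersurfacePoint (totalOverToProjectiveSpace ℂ n d) (AlgPoints.map (regularToTotalSpaceOver ℂ n d) Q) =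
      HodgeTheory.hypersurfacePoint (regularToProjectiveSpace ℂ n d) Q := by
  refine HodgeTheory.hypersurfacePoint_eq_of_projPoint_eq _ _ ?_
  rw [HodgeTheory.projPoint_hypersurfacePoint, ← AlgPoints.map_comp_apply,
    regularToTotalSpaceOver_comp_totalOverToProjectiveSpace]

/-- **The regular locus in coordinates**: a complex point `P` of `𝒴` comes from `𝒴°(ℂ)` iff for some `j` the homogeneous coordinates
`[z](P)` are NOT a projective zero of `∂_j F_P` (Jacobian criterion for the fibres, `mem_regularLocus_iff`, read through the fibre lift).
[cite: Hartshorne1977, I Ex. 5.8] [cite: VoisinHodgeII2003, §2.3.1] -/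
theorem mem_range_map_regularToTotalSpaceOver_iff (P : ComplexPoints (totalSpaceOver ℂ n d)) :
    P ∈ Set.range (AlgPoints.map (regularToTotalSpaceOver ℂ n d) : ComplexPoints (regularTotal ℂ n d) → _) ↔
      ∃ j : Fin (n + 2), HodgeTheory.hypersurfacePoint (totalOverToProjectiveSpace ℂ n d) P ∉
        Projectivization.projZeroLocus {pderiv j (tForm ℂ n d P)} := by
  haveI := isOpenImmersion_regularToTotalSpaceOver_left ℂ n d
  have hrange : Set.range (AlgPoints.map (regularToTotalSpaceOver ℂ n d) : ComplexPoints (regularTotal ℂ n d) → _) =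
      {Q | Q.pt ∈ (regularToTotalSpaceOver ℂ n d).left.opensRange} :=
    AlgPoints.range_map_of_isOpenImmersion_holds (regularToTotalSpaceOver ℂ n d)
  rw [hrange, Set.mem_setOf_eq]
  have hop : (regularToTotalSpaceOver ℂ n d).left.opensRange = regularLocus ℂ n d := by
    change (regularLocus ℂ n d).ι.opensRange = regularLocus ℂ n d
    exact Scheme.Opens.opensRange_ι _
  rw [hop]
  change P.toSpecHom.base (IsLocalRing.closedPoint ℂ) ∈ regularLocus ℂ n d ↔ _
  refine (mem_regularLocus_iff ℂ n d (P.toSpecHom.base (IsLocalRing.closedPoint ℂ))).trans ?_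
  refine exists_congr fun j => ?_
  rw [hypersurfacePoint_mem_projZeroLocus_iff n d P ((isHomogeneous_tForm ℂ n d P).pderiv (i := j)), not_iff_not]
  have h := mem_ideal_totalOverι_iff ℂ n d P (IsLocalRing.closedPoint ℂ) (pderiv j (universalForm ℂ n d))
  rw [← MvPolynomial.pderiv_map] at h
  exact h

end Complex

end Literature.AlgebraicGeometry.Motives.UniversalHypersurface

end
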